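import Literature.Analysis.FunctionSpaces.HolderAlgebra
import Literature.Analysis.FluidPDE.NewtonPotentialHolder
import HarnessLib

/-!
# Hölder estimate for compactly supported Calderón–Zygmund kernels acting on differences

Analysis/FluidPDE support file on the discharge path of the named fact
`Literature.Analysis.FluidPDE.MajdaBertozzi2002_holderEulerLocalExistence`
(`ElgindiBlowupContinuationProofs.lean`), through its Lagrangian decomposition
(`HolderEulerLagrangian.lean`): both halves of that decomposition rest on the Hölder-space
potential theory of the Biot–Savart operator, Majda–Bertozzi, *Vorticity and Incompressible
Flow* (CUP 2002), §4.1.3 **Lemma 4.6**, (4.36), p. 129 of the held text ("`|P_N f|_γ ≤ c‖f‖_γ`"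
for the singular integral operator `P_N = ∇K_N` on compactly supported `f ∈ C^γ`, `0 < γ < 1`),
i.e. Gilbarg–Trudinger 2001, **Lemma 4.4** (interior `C^{2,α}` estimate for the Newtonian
potential). This file proves the abstract core of that estimate, in a **sphere-free** form
adapted to the tree's smooth near/far splitting of the Newtonian kernel (`NewtonKernel.lean`):

* `IsHolderCZKernel K ρ A B A₀`: a measurable kernel `K : ℝ³ → ℝ` with the size and
  Hörmander regularity of a homogeneous kernel of degree `−3` (the tree's
  `NewtonPotentialHolder.IsSingularKernel K 3 A B`: `|K(z)| ≤ A|z|⁻³`,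
  `|K(x−y) − K(z−y)| ≤ B|x−z||x−y|⁻⁴` for `|x−y| ≥ 2|x−z|`), vanishing off the ball of radius
  `ρ`, and satisfying the **smooth-truncation cancellation bound**
  `|∫ (1 − θ(d⁻¹(z + w))) K(z) dz| ≤ A₀` for all `d > 0`, `|w| ≤ d`, where
  `θ = radialCutoff 2 3` (`= 1` on `|u| ≤ 2`, `= 0` on `|u| ≥ 3`). For `K = ∂_b∂_aΓ₀`
  (`Γ₀ = θ'Γ` the compactly supported near part of the Newtonian kernel) the last bound is an
  integration by parts — this replaces the mean-zero property on spheres ((4.32)) and the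
  boundary integrals of Gilbarg–Trudinger's proof (their terms `I₂`, `I₅`).
* `czDiff K f x = ∫ K(x − y) • (f(y) − f(x)) dy` — the singular integral acting on differences,
  absolutely convergent for Hölder `f` (this is `D_{ab}(Γ₀ ⋆ f)`, (4.10)/Lemma 4.2 of
  Gilbarg–Trudinger without boundary term, see `NewtonNearCZ`/`NewtonNearPotentialC1`).
* `norm_czDiff_le`: `‖czDiff K f x‖ ≤ A C · 3|B₁| · ρ^γ/γ` for `f` `γ`-Hölder with constant `C`.
* `norm_czDiff_sub_le` — **the Hölder estimate**:
  `‖czDiff K f x − czDiff K f x̄‖ ≤ C (7A·3|B₁|/γ + B·3|B₁|/(1−γ) + A₀) |x − x̄|^γ` for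
  `0 < γ < 1`. Proof (Majda–Bertozzi, proof of Lemma 4.6, §4.5 p. 144–145; Gilbarg–Trudinger
  Lemma 4.4): with `d = |x − x̄|` split both integrals smoothly by `θ(d⁻¹(x − y))`; the near
  parts are `≤ AC·3|B₁|(3d)^γ/γ` and `≤ AC·3|B₁|(4d)^γ/γ` (`norm_integral_le_of_indicator_ball`);
  the far parts differ by `∫ φ (K(x−y) − K(x̄−y))(f y − f x)`, bounded through the regularity of
  `K` by `BC·3|B₁| d (2d)^{γ−1}/(1−γ)` (`norm_integral_czFar_sub_le`), plus
  `(∫ φ(y) K(x̄−y) dy) • (f x̄ − f x)`, bounded by `A₀ C d^γ` through the cancellation bound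
  (`norm_integral_czFar_cancel_le`).

All bounds on Bochner integrals go through `‖∫ g‖ₑ ≤ ∫⁻ ‖g‖ₑ` and the radial integrals of
`NewtonPotentialHolder` (`∫_{B_r} |z|^{γ−3} = 3|B₁| r^γ/γ`, `∫_{|z|≥r} |z|^{γ−4} = 3|B₁| r^{γ−1}/(1−γ)`).

## Mathlib / tree search

Mathlib has Hölder functions (`HolderWith`) but no singular integrals on Hölder spaces
(`lean search 'Calderon|singular integral|Holder.*kernel'`: the tree's
`SingularIntegrals/CalderonZygmund*.lean` are the `L^p`/weak-`(1,1)` theory, and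
`NewtonPotentialHolder.lean` treats `L^p` densities against kernels of degree `> −3`). Used:
`IsSingularKernel`, `lintegral_ball_norm_rpow_neg`, `lintegral_compl_ball_norm_rpow_neg`,
`lintegral_ball_comp_sub_left`, `lintegral_compl_ball_comp_sub_left`,
`integrableOn_ball_norm_rpow_neg` (`NewtonPotentialHolder`); `radialCutoff` (`NewtonKernel`);
`FunctionSpaces.holderWith_of_dist_le` (`HolderAlgebra`); Mathlib `HolderWith.dist_le`,
`enorm_integral_le_lintegral_enorm`, `integral_sub_left_eq_self`, `Integrable.comp_sub_left`,
`Integrable.bdd_smul`.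

## References

* A. J. Majda, A. L. Bertozzi, *Vorticity and Incompressible Flow* (CUP 2002), §4.1.3
  Lemma 4.6 (4.35)–(4.36), p. 129; proof §4.5, p. 144–145. [MajdaBertozziCUP2002]
* D. Gilbarg, N. S. Trudinger, *Elliptic Partial Differential Equations of Second Order*
  (2001), Lemma 4.4 with (4.10). [GilbargTrudinger2001]
-/

noncomputable section

open MeasureTheory Set Function Filter Metric Real
open _root_.Topology
open scoped NNReal ENNReal

namespace Literature.Analysis.FluidPDE

open NewtonPotentialHolder

/-- Local notation for physical space `ℝ³ = EuclideanSpace ℝ (Fin 3)`. -/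
local notation "ℝ³" => EuclideanSpace ℝ (Fin 3)

/-! ### The kernel class and the operator on differences -/

/-- **Compactly supported Calderón–Zygmund kernels of Hölder theory.** A measurable kernel
`K : ℝ³ → ℝ` with `|K(z)| ≤ A|z|⁻³`, `|K(x − y) − K(z − y)| ≤ B|x − z||x − y|⁻⁴` for
`|x − y| ≥ 2|x − z|` (`IsSingularKernel K 3 A B`), vanishing for `|z| ≥ ρ`, and with the
smooth-truncation cancellation bound `|∫ (1 − θ(d⁻¹(z + w))) K(z) dz| ≤ A₀` for `d > 0`,
`|w| ≤ d`, `θ = radialCutoff 2 3` (the substitute for the mean-zero property (4.32) of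
Majda–Bertozzi's `P_N` on spheres). Example: `∂_b∂_a(θ'Γ)` for the Newtonian kernel `Γ`
(`NewtonNearCZ.lean`). [folklore] -/
structure IsHolderCZKernel (K : ℝ³ → ℝ) (ρ A B A₀ : ℝ) : Prop where
  /-- Size `A|z|⁻³` and Hörmander regularity `B|x − z||x − y|⁻⁴`. -/
  singular : IsSingularKernel K 3 A B
  /-- The kernel vanishes off the open ball of radius `ρ`. -/
  eq_zero_of_le : ∀ z, ρ ≤ ‖z‖ → K z = 0
  /-- The smooth-truncation cancellation bound. -/
  abs_integral_truncate_le : ∀ (w : ℝ³) (d : ℝ), 0 < d → ‖w‖ ≤ d →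
    |∫ z, (1 - radialCutoff 2 3 (d⁻¹ • (z + w))) * K z| ≤ A₀

variable {F : Type*} [NormedAddCommGroup F] [NormedSpace ℝ F]

/-- **The singular integral acting on differences**:
`czDiff K f x = ∫ K(x − y) • (f(y) − f(x)) dy` (Gilbarg–Trudinger (4.10) without boundary
term; for `K = ∂_b∂_aΓ₀` and Hölder `f` this is `∂_b∂_a(Γ₀ ⋆ f)(x)`). Bochner integral, junk `0`
where the integrand is not integrable (it is, for `IsHolderCZKernel` and Hölder `f`,
`integrable_czDiff`). [cite: GilbargTrudinger2001, Lemma 4.4 with (4.10)] -/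
def czDiff (K : ℝ³ → ℝ) (f : ℝ³ → F) (x : ℝ³) : F :=
  ∫ y, K (x - y) • (f y - f x)

variable {K : ℝ³ → ℝ} {ρ A B A₀ : ℝ} {f : ℝ³ → F} {C γ : ℝ≥0}

/-! ### Signs of the constants -/

namespace IsHolderCZKernel

/-- The size constant is nonnegative (evaluate the size bound at a unit vector). [folklore] -/
theorem nonneg_A (hK : IsHolderCZKernel K ρ A B A₀) : 0 ≤ A := by
  set e : ℝ³ := EuclideanSpace.single 0 1 with he
  have hen : ‖e‖ = 1 := by simp [he]
  have h := hK.singular.abs_le e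
  rw [hen, Real.one_rpow, mul_one] at h
  exact (abs_nonneg _).trans h

/-- The regularity constant is nonnegative (evaluate the regularity bound at `x = 0`, `z = e`,
`y = −2e`). [folklore] -/
theorem nonneg_B (hK : IsHolderCZKernel K ρ A B A₀) : 0 ≤ B := by
  set e : ℝ³ := EuclideanSpace.single 0 1 with he
  have hen : ‖e‖ = 1 := by simp [he]
  have hne : (0 : ℝ³) ≠ e := fun h => by
    have := congrArg (fun v : ℝ³ => ‖v‖) h
    simp [hen] at this
  have n1 : ‖(0 : ℝ³) - e‖ = 1 := by rw [zero_sub, norm_neg, hen]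
  have n2 : ‖(0 : ℝ³) - (-2 : ℝ) • e‖ = 2 := by
    rw [zero_sub, norm_neg, norm_smul, hen, Real.norm_eq_abs]
    norm_num
  have h := hK.singular.abs_sub_le 0 e ((-2 : ℝ) • e) hne (by rw [n1, n2]; norm_num)
  rw [n1, n2, mul_one] at h
  have hpos : (0 : ℝ) < (2 : ℝ) ^ (-(3 + 1 : ℝ)) := Real.rpow_pos_of_pos two_pos _
  have h' : 0 ≤ B * (2 : ℝ) ^ (-(3 + 1 : ℝ)) := (abs_nonneg _).trans h
  by_contra hB
  exact absurd h' (not_le.2 (mul_neg_of_neg_of_pos (not_le.1 hB) hpos))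

/-- The cancellation constant is nonnegative. [folklore] -/
theorem nonneg_A₀ (hK : IsHolderCZKernel K ρ A B A₀) : 0 ≤ A₀ :=
  (abs_nonneg _).trans (hK.abs_integral_truncate_le 0 1 one_pos (by simp))

/-- The support radius is positive unless the kernel vanishes identically; in any case the
kernel vanishes off the ball of radius `max ρ 1 > 0`, so we may assume `0 < ρ`. [folklore] -/
theorem of_le_radius (hK : IsHolderCZKernel K ρ A B A₀) {ρ' : ℝ} (h : ρ ≤ ρ') :
    IsHolderCZKernel K ρ' A B A₀ :=
  ⟨hK.singular, fun z hz => hK.eq_zero_of_le z (h.trans hz), hK.abs_integral_truncate_le⟩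

/-- The kernel is measurable. [folklore] -/
theorem measurable (hK : IsHolderCZKernel K ρ A B A₀) : Measurable K :=
  hK.singular.measurable

end IsHolderCZKernel

/-! ### Pointwise bounds for the integrand -/

omit [NormedSpace ℝ F] in
/-- Hölder continuity in norm form: `‖f y − f x‖ ≤ C |x − y|^γ`. [folklore] -/
theorem holder_norm_sub_le (hf : HolderWith C γ f) (x y : ℝ³) :
    ‖f y - f x‖ ≤ C * ‖x - y‖ ^ (γ : ℝ) := by
  have h := hf.dist_le y x
  rwa [dist_eq_norm, dist_eq_norm, norm_sub_rev y x] at h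

/-- **Size of the integrand**: `‖K(x − y) • (f y − f x)‖ ≤ A C |x − y|^{γ−3}`. [folklore] -/
theorem IsHolderCZKernel.norm_smul_sub_le (hK : IsHolderCZKernel K ρ A B A₀) (hf : HolderWith C γ f)
    (hγ : γ < 3) (x y : ℝ³) :
    ‖K (x - y) • (f y - f x)‖ ≤ A * C * ‖x - y‖ ^ ((γ : ℝ) - 3) := by
  rw [norm_smul, Real.norm_eq_abs]
  have h1 := hK.singular.abs_le (x - y)
  have h2 := holder_norm_sub_le hf x y
  have hγ3 : (-3 : ℝ) + γ ≠ 0 := by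
    have : (γ : ℝ) < 3 := by exact_mod_cast hγ
    linarith
  calc |K (x - y)| * ‖f y - f x‖ ≤ (A * ‖x - y‖ ^ (-(3 : ℝ))) * (C * ‖x - y‖ ^ (γ : ℝ)) :=
        mul_le_mul h1 h2 (norm_nonneg _) ((abs_nonneg _).trans h1)
    _ = A * C * (‖x - y‖ ^ (-(3 : ℝ)) * ‖x - y‖ ^ (γ : ℝ)) := by ring
    _ = A * C * ‖x - y‖ ^ ((γ : ℝ) - 3) := by
        rw [← Real.rpow_add' (norm_nonneg _) hγ3]
        ring_nf

/-- The integrand vanishes where `|x − y| ≥ ρ`. [folklore] -/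
theorem IsHolderCZKernel.smul_sub_eq_zero_of_le (hK : IsHolderCZKernel K ρ A B A₀) {x y : ℝ³} (h : ρ ≤ ‖x - y‖) :
    K (x - y) • (f y - f x) = 0 := by
  rw [hK.eq_zero_of_le _ h, zero_smul]

/-- **Indicator majorant**: `‖K(x − y) • (f y − f x)‖ₑ ≤ 1_{B(x,ρ)}(y) A C |x − y|^{γ−3}`. [folklore] -/
theorem IsHolderCZKernel.enorm_smul_sub_le_indicator (hK : IsHolderCZKernel K ρ A B A₀) (hf : HolderWith C γ f)
    (hγ : γ < 3) (x y : ℝ³) :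
    ‖K (x - y) • (f y - f x)‖ₑ ≤
      (ball x ρ).indicator (fun y => ENNReal.ofReal (A * C * ‖x - y‖ ^ ((γ : ℝ) - 3))) y := by
  by_cases hy : y ∈ ball x ρ
  · rw [indicator_of_mem hy, ← ofReal_norm]
    exact ENNReal.ofReal_le_ofReal (hK.norm_smul_sub_le hf hγ x y)
  · rw [indicator_of_notMem hy, hK.smul_sub_eq_zero_of_le ?_, enorm_zero]
    rw [mem_ball, dist_eq_norm, norm_sub_rev, not_lt] at hy
    exact hy

/-! ### Radial integrals of the majorants -/

/-- `∫⁻_{B(p,r)} |p − y|^{γ−3} dy = 3|B₁| r^γ/γ` (`0 < γ`, `0 < r`). [folklore] -/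
theorem lintegral_ball_norm_sub_rpow {γ' : ℝ} (hγ : 0 < γ') (p : ℝ³) {r : ℝ} (hr : 0 < r) :
    ∫⁻ y in ball p r, ENNReal.ofReal (‖p - y‖ ^ (γ' - 3)) =
      ENNReal.ofReal (3 * (volume : Measure ℝ³).real (ball 0 1) * (r ^ γ' / γ')) := by
  have hs : (3 : ℝ) - γ' < 3 := by linarith
  have e1 : ∀ z : ℝ³, ‖z‖ ^ (γ' - 3) = ‖z‖ ^ (-(3 - γ')) := fun z => by rw [neg_sub]
  rw [lintegral_ball_comp_sub_left (fun z => ENNReal.ofReal (‖z‖ ^ (γ' - 3))) p r]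
  simp_rw [e1]
  rw [lintegral_ball_norm_rpow_neg hs hr, sub_sub_cancel]

/-- `∫⁻_{|x−y| ≥ r} |x − y|^{γ−4} dy = 3|B₁| r^{γ−1}/(1−γ)` (`γ < 1`, `0 < r`). [folklore] -/
theorem lintegral_compl_ball_norm_sub_rpow {γ' : ℝ} (hγ : γ' < 1) (x : ℝ³) {r : ℝ} (hr : 0 < r) :
    ∫⁻ y in (ball x r)ᶜ, ENNReal.ofReal (‖x - y‖ ^ (γ' - 4)) =
      ENNReal.ofReal (3 * (volume : Measure ℝ³).real (ball 0 1) * (r ^ (γ' - 1) / (1 - γ'))) := by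
  have ht : (3 : ℝ) < 4 - γ' := by linarith
  have e1 : ∀ z : ℝ³, ‖z‖ ^ (γ' - 4) = ‖z‖ ^ (-(4 - γ')) := fun z => by rw [neg_sub]
  rw [lintegral_compl_ball_comp_sub_left (fun z => ENNReal.ofReal (‖z‖ ^ (γ' - 4))) x r]
  simp_rw [e1]
  rw [lintegral_compl_ball_norm_rpow_neg ht hr]
  congr 2
  rw [show (3 : ℝ) - (4 - γ') = γ' - 1 by ring, show (4 : ℝ) - γ' - 3 = 1 - γ' by ring]

/-- **Integration of an indicator majorant on a ball**: if `‖G y‖ₑ ≤ 1_{B(p,r)}(y) M|p − y|^{γ−3}`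
with `M ≥ 0`, then `‖∫ G‖ ≤ M · 3|B₁| · r^γ/γ`. [folklore] -/
theorem norm_integral_le_of_indicator_ball {G : ℝ³ → F} {p : ℝ³} {r M γ' : ℝ} (hγ : 0 < γ')
    (hr : 0 < r) (hM : 0 ≤ M)
    (h : ∀ y, ‖G y‖ₑ ≤ (ball p r).indicator (fun y => ENNReal.ofReal (M * ‖p - y‖ ^ (γ' - 3))) y) :
    ‖∫ y, G y‖ ≤ M * (3 * (volume : Measure ℝ³).real (ball 0 1)) * (r ^ γ' / γ') := by
  have hmeas : Measurable fun y : ℝ³ => ENNReal.ofReal (‖p - y‖ ^ (γ' - 3)) :=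
    ((continuous_const.sub continuous_id).norm.measurable.pow_const _).ennreal_ofReal
  have h1 : ‖∫ y, G y‖ₑ ≤
      ENNReal.ofReal (M * (3 * (volume : Measure ℝ³).real (ball 0 1)) * (r ^ γ' / γ')) := by
    calc ‖∫ y, G y‖ₑ ≤ ∫⁻ y, ‖G y‖ₑ := enorm_integral_le_lintegral_enorm _
      _ ≤ ∫⁻ y, (ball p r).indicator (fun y => ENNReal.ofReal (M * ‖p - y‖ ^ (γ' - 3))) y :=
          lintegral_mono h
      _ = ∫⁻ y in ball p r, ENNReal.ofReal M * ENNReal.ofReal (‖p - y‖ ^ (γ' - 3)) := by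
          rw [lintegral_indicator measurableSet_ball]
          refine setLIntegral_congr_fun measurableSet_ball fun y _ => ?_
          rw [ENNReal.ofReal_mul hM]
      _ = ENNReal.ofReal M * ∫⁻ y in ball p r, ENNReal.ofReal (‖p - y‖ ^ (γ' - 3)) := by
          rw [lintegral_const_mul _ hmeas]
      _ = ENNReal.ofReal (M * (3 * (volume : Measure ℝ³).real (ball 0 1)) * (r ^ γ' / γ')) := by
          rw [lintegral_ball_norm_sub_rpow hγ p hr, ← ENNReal.ofReal_mul hM]
          congr 1
          ring
  rw [← ofReal_norm] at h1
  exact (ENNReal.ofReal_le_ofReal_iff (by positivity)).1 h1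

/-! ### Integrability and the sup bound -/

section Bounds

/-- The integrand `y ↦ K(x − y) • (f y − f x)` is a.e.-strongly measurable. [folklore] -/
theorem IsHolderCZKernel.aestronglyMeasurable_smul_sub (hK : IsHolderCZKernel K ρ A B A₀) (hf : HolderWith C γ f)
    (hγ : 0 < γ) (x : ℝ³) :
    AEStronglyMeasurable (fun y => K (x - y) • (f y - f x)) volume :=
  ((hK.measurable.comp (measurable_const.sub measurable_id)).aestronglyMeasurable).smul
    ((hf.continuous hγ).sub continuous_const).aestronglyMeasurable

/-- **The singular integral on differences converges absolutely** for Hölder `f`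
(`|K(x−y)||f(y) − f(x)| ≤ AC|x−y|^{γ−3}` on the ball `|x − y| < ρ`, integrable since
`γ > 0`). [folklore] -/
theorem IsHolderCZKernel.integrable_czDiff (hK : IsHolderCZKernel K ρ A B A₀) (hf : HolderWith C γ f)
    (hγ : 0 < γ) (hγ1 : γ < 1) (x : ℝ³) :
    Integrable (fun y => K (x - y) • (f y - f x)) := by
  have hγ3 : γ < 3 := hγ1.trans (by norm_num)
  have hs : (3 : ℝ) - γ < 3 := by
    have : (0 : ℝ) < γ := by exact_mod_cast hγ
    linarith
  -- the majorant `z ↦ 1_{B(0,ρ)}(z) AC|z|^{γ-3}`, translated to `x - y`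
  set m : ℝ³ → ℝ := (ball (0 : ℝ³) ρ).indicator fun z => A * C * ‖z‖ ^ ((γ : ℝ) - 3) with hm
  have hmi : Integrable m := by
    rw [hm]
    refine IntegrableOn.integrable_indicator ?_ measurableSet_ball
    have h0 : IntegrableOn (fun z : ℝ³ => A * C * ‖z‖ ^ (-(3 - (γ : ℝ)))) (ball 0 ρ) :=
      (integrableOn_ball_norm_rpow_neg hs ρ).const_mul (A * C)
    refine IntegrableOn.congr_fun h0 (fun z _ => ?_) measurableSet_ball
    rw [neg_sub]
  refine Integrable.mono' (hmi.comp_sub_left x) (hK.aestronglyMeasurable_smul_sub hf hγ x)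
    (Eventually.of_forall fun y => ?_)
  by_cases hy : x - y ∈ ball (0 : ℝ³) ρ
  · rw [hm, indicator_of_mem hy]
    exact hK.norm_smul_sub_le hf hγ3 x y
  · rw [hm, indicator_of_notMem hy, hK.smul_sub_eq_zero_of_le ?_, norm_zero]
    rwa [mem_ball_zero_iff, not_lt] at hy

/-- **Sup bound**: `‖czDiff K f x‖ ≤ A C · 3|B₁| · ρ^γ/γ` (Majda–Bertozzi, the `ε^γ |f|_γ`
term of (4.35)). [cite: MajdaBertozziCUP2002, §4.1.3 Lemma 4.6 (4.35) (p. 129)] -/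
theorem IsHolderCZKernel.norm_czDiff_le (hK : IsHolderCZKernel K ρ A B A₀) (hρ : 0 < ρ) (hf : HolderWith C γ f)
    (hγ : 0 < γ) (hγ1 : γ < 1) (x : ℝ³) :
    ‖czDiff K f x‖ ≤
      A * C * (3 * (volume : Measure ℝ³).real (ball 0 1)) * (ρ ^ (γ : ℝ) / γ) := by
  have hγ3 : γ < 3 := hγ1.trans (by norm_num)
  have hγ' : (0 : ℝ) < γ := by exact_mod_cast hγ
  exact norm_integral_le_of_indicator_ball hγ' hρ (mul_nonneg hK.nonneg_A C.coe_nonneg)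
    (fun y => hK.enorm_smul_sub_le_indicator hf hγ3 x y)

end Bounds

/-! ### The three pieces of the Hölder estimate -/

section Pieces

/-- **Near piece.** If a real weight `ψ` with `|ψ| ≤ 1` vanishes off a ball `B(p, r)`, then
`‖∫ ψ(y) • (K(p − y) • (f y − f p)) dy‖ ≤ A C · 3|B₁| · r^γ/γ`. [folklore] -/
theorem IsHolderCZKernel.norm_integral_czNear_le (hK : IsHolderCZKernel K ρ A B A₀) (hf : HolderWith C γ f)
    (hγ : 0 < γ) (hγ1 : γ < 1) {ψ : ℝ³ → ℝ} (hψ1 : ∀ y, |ψ y| ≤ 1) {p : ℝ³} {r : ℝ} (hr : 0 < r)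
    (hψ0 : ∀ y, y ∉ ball p r → ψ y = 0) :
    ‖∫ y, ψ y • (K (p - y) • (f y - f p))‖ ≤
      A * C * (3 * (volume : Measure ℝ³).real (ball 0 1)) * (r ^ (γ : ℝ) / γ) := by
  have hγ3 : γ < 3 := hγ1.trans (by norm_num)
  have hγ' : (0 : ℝ) < γ := by exact_mod_cast hγ
  refine norm_integral_le_of_indicator_ball (p := p) hγ' hr
    (mul_nonneg hK.nonneg_A C.coe_nonneg) fun y => ?_
  by_cases hy : y ∈ ball p r
  · rw [indicator_of_mem hy, ← ofReal_norm]
    refine ENNReal.ofReal_le_ofReal ?_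
    rw [norm_smul, Real.norm_eq_abs]
    calc |ψ y| * ‖K (p - y) • (f y - f p)‖ ≤ 1 * ‖K (p - y) • (f y - f p)‖ := by
          gcongr
          exact hψ1 y
      _ ≤ A * C * ‖p - y‖ ^ ((γ : ℝ) - 3) := by
          rw [one_mul]
          exact hK.norm_smul_sub_le hf hγ3 p y
  · rw [indicator_of_notMem hy, hψ0 y hy, zero_smul, enorm_zero]

/-- **Far piece, regularity.** If a real weight `φ` with `|φ| ≤ 1` vanishes on the ball
`|x − y| < 2d`, `d = |x − x̄| > 0`, then
`‖∫ φ(y) • ((K(x − y) − K(x̄ − y)) • (f y − f x)) dy‖ ≤ B C · 3|B₁| · d (2d)^{γ−1}/(1−γ)`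
(Hörmander regularity of `K` on `|x − y| ≥ 2|x − x̄|`, `γ < 1`). [folklore] -/
theorem IsHolderCZKernel.norm_integral_czFar_sub_le (hK : IsHolderCZKernel K ρ A B A₀) (hf : HolderWith C γ f)
    (hγ1 : γ < 1) {φ : ℝ³ → ℝ} (hφ1 : ∀ y, |φ y| ≤ 1) {x x' : ℝ³} (hxx' : x ≠ x')
    (hφ0 : ∀ y, ‖x - y‖ < 2 * ‖x - x'‖ → φ y = 0) :
    ‖∫ y, φ y • ((K (x - y) - K (x' - y)) • (f y - f x))‖ ≤
      B * C * (3 * (volume : Measure ℝ³).real (ball 0 1)) *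
        (‖x - x'‖ * ((2 * ‖x - x'‖) ^ ((γ : ℝ) - 1) / (1 - γ))) := by
  have hd0 : 0 < ‖x - x'‖ := norm_pos_iff.2 (sub_ne_zero.2 hxx')
  have hγ1' : (γ : ℝ) < 1 := by exact_mod_cast hγ1
  have hBC : 0 ≤ B * C * ‖x - x'‖ := mul_nonneg (mul_nonneg hK.nonneg_B C.coe_nonneg) hd0.le
  have hγ4 : (-(3 + 1) : ℝ) + γ ≠ 0 := by linarith
  -- pointwise majorant off the ball `B(x, 2d)`
  have hpt : ∀ y, ‖φ y • ((K (x - y) - K (x' - y)) • (f y - f x))‖ₑ ≤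
      (ball x (2 * ‖x - x'‖))ᶜ.indicator
        (fun y => ENNReal.ofReal (B * C * ‖x - x'‖) * ENNReal.ofReal (‖x - y‖ ^ ((γ : ℝ) - 4))) y := by
    intro y
    by_cases hy : y ∈ (ball x (2 * ‖x - x'‖))ᶜ
    · rw [indicator_of_mem hy, ← ENNReal.ofReal_mul hBC, ← ofReal_norm]
      refine ENNReal.ofReal_le_ofReal ?_
      have hy' : 2 * ‖x - x'‖ ≤ ‖x - y‖ := by
        rw [mem_compl_iff, mem_ball, dist_eq_norm, norm_sub_rev, not_lt] at hy
        exact hy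
      have h1 := hK.singular.abs_sub_le x x' y hxx' hy'
      have h2 := holder_norm_sub_le hf x y
      rw [norm_smul, norm_smul, Real.norm_eq_abs, Real.norm_eq_abs]
      calc |φ y| * (|K (x - y) - K (x' - y)| * ‖f y - f x‖)
          ≤ 1 * ((B * ‖x - x'‖ * ‖x - y‖ ^ (-(3 + 1 : ℝ))) * (C * ‖x - y‖ ^ (γ : ℝ))) := by
            refine mul_le_mul (hφ1 y) (mul_le_mul h1 h2 (norm_nonneg _)
              ((abs_nonneg _).trans h1)) (by positivity) zero_le_one
        _ = B * C * ‖x - x'‖ * (‖x - y‖ ^ (-(3 + 1 : ℝ)) * ‖x - y‖ ^ (γ : ℝ)) := by ring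
        _ = B * C * ‖x - x'‖ * ‖x - y‖ ^ ((γ : ℝ) - 4) := by
            rw [← Real.rpow_add' (norm_nonneg _) hγ4]
            congr 1
            norm_num
            ring_nf
    · rw [indicator_of_notMem hy, hφ0 y ?_, zero_smul, enorm_zero]
      rw [mem_compl_iff, not_not, mem_ball, dist_eq_norm, norm_sub_rev] at hy
      exact hy
  have hmeas : Measurable fun y : ℝ³ => ENNReal.ofReal (‖x - y‖ ^ ((γ : ℝ) - 4)) :=
    ((continuous_const.sub continuous_id).norm.measurable.pow_const _).ennreal_ofReal
  have h1 : ‖∫ y, φ y • ((K (x - y) - K (x' - y)) • (f y - f x))‖ₑ ≤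
      ENNReal.ofReal (B * C * (3 * (volume : Measure ℝ³).real (ball 0 1)) *
        (‖x - x'‖ * ((2 * ‖x - x'‖) ^ ((γ : ℝ) - 1) / (1 - γ)))) := by
    calc ‖∫ y, φ y • ((K (x - y) - K (x' - y)) • (f y - f x))‖ₑ
        ≤ ∫⁻ y, ‖φ y • ((K (x - y) - K (x' - y)) • (f y - f x))‖ₑ :=
          enorm_integral_le_lintegral_enorm _
      _ ≤ ∫⁻ y, (ball x (2 * ‖x - x'‖))ᶜ.indicator
          (fun y => ENNReal.ofReal (B * C * ‖x - x'‖) * ENNReal.ofReal (‖x - y‖ ^ ((γ : ℝ) - 4))) y :=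
          lintegral_mono hpt
      _ = ENNReal.ofReal (B * C * ‖x - x'‖) *
            ∫⁻ y in (ball x (2 * ‖x - x'‖))ᶜ, ENNReal.ofReal (‖x - y‖ ^ ((γ : ℝ) - 4)) := by
          rw [lintegral_indicator measurableSet_ball.compl, lintegral_const_mul _ hmeas]
      _ = ENNReal.ofReal (B * C * (3 * (volume : Measure ℝ³).real (ball 0 1)) *
            (‖x - x'‖ * ((2 * ‖x - x'‖) ^ ((γ : ℝ) - 1) / (1 - γ)))) := by
          rw [lintegral_compl_ball_norm_sub_rpow hγ1' x (by positivity : 0 < 2 * ‖x - x'‖),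
            ← ENNReal.ofReal_mul hBC]
          congr 1
          ring
  rw [← ofReal_norm] at h1
  refine (ENNReal.ofReal_le_ofReal_iff ?_).1 h1
  have : 0 ≤ (2 * ‖x - x'‖) ^ ((γ : ℝ) - 1) / (1 - γ) :=
    div_nonneg (Real.rpow_nonneg (by positivity) _) (by linarith)
  exact mul_nonneg (mul_nonneg (mul_nonneg hK.nonneg_B C.coe_nonneg)
    three_mul_volume_real_ball_nonneg) (mul_nonneg hd0.le this)

/-- **Far piece, cancellation.** With the smooth truncation
`φ(y) = 1 − θ(d⁻¹(x − y))`, `d = |x − x̄| > 0`: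
`‖(∫ φ(y) K(x̄ − y) dy) • (f x̄ − f x)‖ ≤ A₀ C d^γ` (substitute `y = x̄ − z` and use the
cancellation bound of the kernel with `w = x − x̄`). [folklore] -/
theorem IsHolderCZKernel.norm_integral_czFar_cancel_le (hK : IsHolderCZKernel K ρ A B A₀) (hf : HolderWith C γ f)
    {x x' : ℝ³} (hxx' : x ≠ x') :
    ‖(∫ y, (1 - radialCutoff 2 3 (‖x - x'‖⁻¹ • (x - y))) * K (x' - y)) • (f x' - f x)‖ ≤
      A₀ * C * ‖x - x'‖ ^ (γ : ℝ) := by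
  set d : ℝ := ‖x - x'‖ with hd
  have hd0 : 0 < d := norm_pos_iff.2 (sub_ne_zero.2 hxx')
  -- substitution `y = x' - z`
  have hsub : ∫ y, (1 - radialCutoff 2 3 (d⁻¹ • (x - y))) * K (x' - y) =
      ∫ z, (1 - radialCutoff 2 3 (d⁻¹ • (z + (x - x')))) * K z := by
    rw [← integral_sub_left_eq_self
      (fun z => (1 - radialCutoff 2 3 (d⁻¹ • (z + (x - x')))) * K z) volume x']
    congr 1
    funext y
    congr 3
    abel
  have hcan := hK.abs_integral_truncate_le (x - x') d hd0 le_rfl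
  rw [norm_smul, Real.norm_eq_abs, hsub]
  calc |∫ z, (1 - radialCutoff 2 3 (d⁻¹ • (z + (x - x')))) * K z| * ‖f x' - f x‖
      ≤ A₀ * (C * ‖x - x'‖ ^ (γ : ℝ)) :=
        mul_le_mul hcan (holder_norm_sub_le hf x x') (norm_nonneg _) hK.nonneg_A₀
    _ = A₀ * C * ‖x - x'‖ ^ (γ : ℝ) := by ring

end Pieces

/-! ### The Hölder estimate -/

section Holder

variable [CompleteSpace F]

/-- Rescaled cutoff facts: with `θ_d(y) = θ(d⁻¹(x − y))`, `θ = radialCutoff 2 3`, `d > 0`: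
`|θ_d| ≤ 1`, `θ_d(y) = 1` for `|x − y| ≤ 2d` and `θ_d(y) = 0` for `|x − y| ≥ 3d`. [folklore] -/
theorem radialCutoff_rescaled_facts {x : ℝ³} {d : ℝ} (hd : 0 < d) :
    (∀ y : ℝ³, |radialCutoff 2 3 (d⁻¹ • (x - y))| ≤ 1) ∧
    (∀ y : ℝ³, ‖x - y‖ ≤ 2 * d → radialCutoff 2 3 (d⁻¹ • (x - y)) = 1) ∧
    (∀ y : ℝ³, 3 * d ≤ ‖x - y‖ → radialCutoff 2 3 (d⁻¹ • (x - y)) = 0) := by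
  have hn : ∀ y : ℝ³, ‖d⁻¹ • (x - y)‖ = d⁻¹ * ‖x - y‖ := fun y => by
    rw [norm_smul, norm_inv, Real.norm_eq_abs, abs_of_pos hd]
  refine ⟨fun y => abs_radialCutoff_le_one 2 3 _, fun y hy => ?_, fun y hy => ?_⟩
  · refine radialCutoff_eq_one (by norm_num) (by norm_num) ?_
    rw [hn, inv_mul_le_iff₀ hd]
    linarith
  · refine radialCutoff_eq_zero (by norm_num) (by norm_num) ?_
    rw [hn, le_inv_mul_iff₀ hd]
    linarith

/-- **The Hölder estimate for the singular integral on differences** (Majda–Bertozzi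
Lemma 4.6 (4.36): `|P_N f|_γ ≤ c‖f‖_γ`; Gilbarg–Trudinger Lemma 4.4): for a kernel in
`IsHolderCZKernel K ρ A B A₀` and a `γ`-Hölder `f` with constant `C`, `0 < γ < 1`,
`‖czDiff K f x − czDiff K f x̄‖ ≤ C (7A·3|B₁|/γ + B·3|B₁|/(1−γ) + A₀) |x − x̄|^γ`.
Proof: smooth split of both integrals by `θ(d⁻¹(x − y))`, `d = |x − x̄|`; near pieces by
`norm_integral_czNear_le` (radii `3d` about `x`, `4d` about `x̄`), far pieces by
`norm_integral_czFar_sub_le` and `norm_integral_czFar_cancel_le`. [cite: MajdaBertozziCUP2002, §4.1.3 Lemma 4.6 (4.36) (p. 129), proof §4.5 (p. 144–145)] -/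
theorem IsHolderCZKernel.norm_czDiff_sub_le (hK : IsHolderCZKernel K ρ A B A₀) (hf : HolderWith C γ f)
    (hγ : 0 < γ) (hγ1 : γ < 1) (x x' : ℝ³) :
    ‖czDiff K f x - czDiff K f x'‖ ≤
      C * (7 * A * (3 * (volume : Measure ℝ³).real (ball 0 1)) / γ +
        B * (3 * (volume : Measure ℝ³).real (ball 0 1)) / (1 - γ) + A₀) * ‖x - x'‖ ^ (γ : ℝ) := by
  have hγ' : (0 : ℝ) < γ := by exact_mod_cast hγ
  have hγ1' : (γ : ℝ) < 1 := by exact_mod_cast hγ1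
  by_cases hxx' : x = x'
  · subst hxx'
    rw [sub_self, norm_zero, sub_self, norm_zero, Real.zero_rpow hγ'.ne', mul_zero]
  set c₃ : ℝ := 3 * (volume : Measure ℝ³).real (ball 0 1) with hc₃
  have hc₃0 : 0 ≤ c₃ := three_mul_volume_real_ball_nonneg
  have hd0 : 0 < ‖x - x'‖ := norm_pos_iff.2 (sub_ne_zero.2 hxx')
  have hA := hK.nonneg_A
  have hB := hK.nonneg_B
  have hA₀ := hK.nonneg_A₀
  have hC : (0 : ℝ) ≤ C := C.coe_nonneg
  -- the smooth weights
  set θd : ℝ³ → ℝ := fun y => radialCutoff 2 3 (‖x - x'‖⁻¹ • (x - y)) with hθd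
  set φ : ℝ³ → ℝ := fun y => 1 - θd y with hφ
  obtain ⟨hθ1, hθone, hθzero⟩ := radialCutoff_rescaled_facts (x := x) hd0
  have hφ1 : ∀ y, |φ y| ≤ 1 := fun y => by
    have h0 := radialCutoff_nonneg 2 3 (‖x - x'‖⁻¹ • (x - y))
    have h1 := radialCutoff_le_one 2 3 (‖x - x'‖⁻¹ • (x - y))
    rw [hφ, abs_le]
    constructor <;> simp only [hθd] <;> linarith
  have hθ0 : ∀ y, y ∉ ball x (3 * ‖x - x'‖) → θd y = 0 := fun y hy => by
    rw [mem_ball, dist_eq_norm, norm_sub_rev, not_lt] at hy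
    exact hθzero y hy
  have hθ0' : ∀ y, y ∉ ball x' (4 * ‖x - x'‖) → θd y = 0 := fun y hy => by
    rw [mem_ball, dist_eq_norm, norm_sub_rev, not_lt] at hy
    refine hθzero y ?_
    have := norm_sub_le_norm_sub_add_norm_sub x' x y
    rw [norm_sub_rev x' x] at this
    linarith
  have hφ0 : ∀ y, ‖x - y‖ < 2 * ‖x - x'‖ → φ y = 0 := fun y hy => by
    simp only [hφ, hθd]
    rw [hθone y hy.le, sub_self]
  -- continuity / measurability of the weights
  have hsm : Continuous fun y : ℝ³ => ‖x - x'‖⁻¹ • (x - y) := by fun_prop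
  have hθc : Continuous θd :=
    (radialCutoff_contDiff (E' := ℝ³) 2 3 (n := 0)).continuous.comp hsm
  have hφc : Continuous φ := continuous_const.sub hθc
  -- the integrands
  set Gx : ℝ³ → F := fun y => K (x - y) • (f y - f x) with hGx
  set Gx' : ℝ³ → F := fun y => K (x' - y) • (f y - f x') with hGx'
  have Ix : Integrable Gx := hK.integrable_czDiff hf hγ hγ1 x
  have Ix' : Integrable Gx' := hK.integrable_czDiff hf hγ hγ1 x'
  have bdd_smul : ∀ {w : ℝ³ → ℝ} {G : ℝ³ → F}, Continuous w → (∀ y, |w y| ≤ 1) →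
      Integrable G → Integrable fun y => w y • G y := fun {w G} hw hw1 hG =>
    hG.bdd_smul 1 hw.aestronglyMeasurable (Eventually.of_forall fun y => by
      rw [Real.norm_eq_abs]; exact hw1 y)
  have Iθx : Integrable fun y => θd y • Gx y := bdd_smul hθc hθ1 Ix
  have Iφx : Integrable fun y => φ y • Gx y := bdd_smul hφc hφ1 Ix
  have Iθx' : Integrable fun y => θd y • Gx' y := bdd_smul hθc hθ1 Ix'
  have Iφx' : Integrable fun y => φ y • Gx' y := bdd_smul hφc hφ1 Ix'
  -- the cancellation integrand `Q` and the regularity integrand `P`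
  set Q : ℝ³ → F := fun y => φ y • (K (x' - y) • (f x' - f x)) with hQ
  set P : ℝ³ → F := fun y => φ y • ((K (x - y) - K (x' - y)) • (f y - f x)) with hP
  have IφK : Integrable fun y => φ y * K (x' - y) := by
    have hmeas : AEStronglyMeasurable (fun y => φ y * K (x' - y)) volume :=
      (hφc.measurable.mul (hK.measurable.comp (measurable_const.sub measurable_id))).aestronglyMeasurable
    have hmaj : Integrable ((ball x' ρ).indicator fun _ : ℝ³ => A * ‖x - x'‖ ^ (-(3 : ℝ))) :=
      (integrableOn_const (measure_ball_lt_top (x := x') (r := ρ)).ne).integrable_indicator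
        measurableSet_ball
    refine hmaj.mono' hmeas (Eventually.of_forall fun y => ?_)
    rw [Real.norm_eq_abs, abs_mul]
    by_cases hy : y ∈ ball x' ρ
    · rw [indicator_of_mem hy]
      by_cases hφy : φ y = 0
      · rw [hφy, abs_zero, zero_mul]; positivity
      · have hfar : 2 * ‖x - x'‖ ≤ ‖x - y‖ := by
          by_contra h
          exact hφy (hφ0 y (not_le.1 h))
        have hd1 : ‖x - x'‖ ≤ ‖x' - y‖ := by
          have := norm_sub_le_norm_sub_add_norm_sub x x' y
          linarith
        calc |φ y| * |K (x' - y)| ≤ 1 * (A * ‖x' - y‖ ^ (-(3 : ℝ))) :=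
              mul_le_mul (hφ1 y) (hK.singular.abs_le _) (abs_nonneg _) zero_le_one
          _ ≤ 1 * (A * ‖x - x'‖ ^ (-(3 : ℝ))) := by
              refine mul_le_mul_of_nonneg_left (mul_le_mul_of_nonneg_left ?_ hA) zero_le_one
              exact Real.rpow_le_rpow_of_nonpos hd0 hd1 (by norm_num)
          _ = A * ‖x - x'‖ ^ (-(3 : ℝ)) := one_mul _
    · rw [indicator_of_notMem hy, hK.eq_zero_of_le (x' - y) ?_, abs_zero, mul_zero]
      rw [mem_ball, dist_eq_norm, norm_sub_rev, not_lt] at hy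
      exact hy
  have IQ : Integrable Q := by
    have : Q = fun y => (φ y * K (x' - y)) • (f x' - f x) := by
      funext y; simp only [hQ, smul_smul]
    rw [this]
    exact IφK.smul_const _
  have hPQ : ∀ y, φ y • Gx y - φ y • Gx' y = P y + Q y := fun y => by
    simp only [hGx, hGx', hP, hQ, smul_sub, sub_smul]
    abel
  have IP : Integrable P := by
    have : P = fun y => (φ y • Gx y - φ y • Gx' y) - Q y := by
      funext y; rw [hPQ]; abel
    rw [this]
    exact (Iφx.sub Iφx').sub IQ
  -- decompositions of the two singular integrals
  have e1 : czDiff K f x = (∫ y, θd y • Gx y) + ∫ y, φ y • Gx y := by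
    rw [← integral_add Iθx Iφx]
    refine integral_congr_ae (Eventually.of_forall fun y => ?_)
    show K (x - y) • (f y - f x) = θd y • Gx y + φ y • Gx y
    rw [← add_smul]
    simp [hφ, hGx]
  have e2 : czDiff K f x' = (∫ y, θd y • Gx' y) + ∫ y, φ y • Gx' y := by
    rw [← integral_add Iθx' Iφx']
    refine integral_congr_ae (Eventually.of_forall fun y => ?_)
    show K (x' - y) • (f y - f x') = θd y • Gx' y + φ y • Gx' y
    rw [← add_smul]
    simp [hφ, hGx']
  have e3 : (∫ y, φ y • Gx y) - (∫ y, φ y • Gx' y) = (∫ y, P y) + ∫ y, Q y := by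
    rw [← integral_sub Iφx Iφx', ← integral_add IP IQ]
    exact integral_congr_ae (Eventually.of_forall hPQ)
  have e4 : ∫ y, Q y = (∫ y, φ y * K (x' - y)) • (f x' - f x) := by
    rw [← integral_smul_const]
    refine integral_congr_ae (Eventually.of_forall fun y => ?_)
    simp only [hQ, smul_smul]
  -- the four bounds
  have bN₁ : ‖∫ y, θd y • Gx y‖ ≤ A * C * c₃ * ((3 * ‖x - x'‖) ^ (γ : ℝ) / γ) :=
    hK.norm_integral_czNear_le hf hγ hγ1 hθ1 (by positivity) hθ0
  have bN₂ : ‖∫ y, θd y • Gx' y‖ ≤ A * C * c₃ * ((4 * ‖x - x'‖) ^ (γ : ℝ) / γ) :=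
    hK.norm_integral_czNear_le hf hγ hγ1 hθ1 (by positivity) hθ0'
  have bP : ‖∫ y, P y‖ ≤ B * C * c₃ *
      (‖x - x'‖ * ((2 * ‖x - x'‖) ^ ((γ : ℝ) - 1) / (1 - γ))) :=
    hK.norm_integral_czFar_sub_le hf hγ1 hφ1 hxx' hφ0
  have bQ : ‖∫ y, Q y‖ ≤ A₀ * C * ‖x - x'‖ ^ (γ : ℝ) := by
    rw [e4]
    exact hK.norm_integral_czFar_cancel_le hf hxx'
  -- elementary inequalities for the powers
  set D : ℝ := ‖x - x'‖ ^ (γ : ℝ) with hD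
  have hD0 : 0 ≤ D := Real.rpow_nonneg hd0.le _
  have p3 : (3 * ‖x - x'‖) ^ (γ : ℝ) ≤ 3 * D := by
    rw [Real.mul_rpow (by norm_num) hd0.le]
    refine mul_le_mul_of_nonneg_right ?_ hD0
    calc (3 : ℝ) ^ (γ : ℝ) ≤ (3 : ℝ) ^ (1 : ℝ) :=
          Real.rpow_le_rpow_of_exponent_le (by norm_num) hγ1'.le
      _ = 3 := Real.rpow_one 3
  have p4 : (4 * ‖x - x'‖) ^ (γ : ℝ) ≤ 4 * D := by
    rw [Real.mul_rpow (by norm_num) hd0.le]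
    refine mul_le_mul_of_nonneg_right ?_ hD0
    calc (4 : ℝ) ^ (γ : ℝ) ≤ (4 : ℝ) ^ (1 : ℝ) :=
          Real.rpow_le_rpow_of_exponent_le (by norm_num) hγ1'.le
      _ = 4 := Real.rpow_one 4
  have p2 : ‖x - x'‖ * (2 * ‖x - x'‖) ^ ((γ : ℝ) - 1) ≤ D := by
    rw [Real.mul_rpow (by norm_num) hd0.le]
    have h2 : (2 : ℝ) ^ ((γ : ℝ) - 1) ≤ 1 :=
      Real.rpow_le_one_of_one_le_of_nonpos (by norm_num) (by linarith)
    have hpow : ‖x - x'‖ * ‖x - x'‖ ^ ((γ : ℝ) - 1) = D := by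
      rw [hD]
      conv_lhs => rw [show ‖x - x'‖ * ‖x - x'‖ ^ ((γ : ℝ) - 1) =
        ‖x - x'‖ ^ (1 : ℝ) * ‖x - x'‖ ^ ((γ : ℝ) - 1) by rw [Real.rpow_one]]
      rw [← Real.rpow_add hd0]
      ring_nf
    calc ‖x - x'‖ * ((2 : ℝ) ^ ((γ : ℝ) - 1) * ‖x - x'‖ ^ ((γ : ℝ) - 1))
        = (2 : ℝ) ^ ((γ : ℝ) - 1) * (‖x - x'‖ * ‖x - x'‖ ^ ((γ : ℝ) - 1)) := by ring
      _ ≤ 1 * (‖x - x'‖ * ‖x - x'‖ ^ ((γ : ℝ) - 1)) :=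
          mul_le_mul_of_nonneg_right h2 (mul_nonneg hd0.le (Real.rpow_nonneg hd0.le _))
      _ = D := by rw [one_mul, hpow]
  have h1γ : 0 < 1 - (γ : ℝ) := by linarith
  have bN : ‖∫ y, θd y • Gx y‖ + ‖∫ y, θd y • Gx' y‖ ≤ A * C * c₃ * (7 * D / γ) := by
    have : (3 * ‖x - x'‖) ^ (γ : ℝ) / γ + (4 * ‖x - x'‖) ^ (γ : ℝ) / γ ≤ 7 * D / γ := by
      rw [← add_div]
      exact div_le_div_of_nonneg_right (by linarith) hγ'.le
    calc ‖∫ y, θd y • Gx y‖ + ‖∫ y, θd y • Gx' y‖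
        ≤ A * C * c₃ * ((3 * ‖x - x'‖) ^ (γ : ℝ) / γ) +
            A * C * c₃ * ((4 * ‖x - x'‖) ^ (γ : ℝ) / γ) := add_le_add bN₁ bN₂
      _ = A * C * c₃ * ((3 * ‖x - x'‖) ^ (γ : ℝ) / γ + (4 * ‖x - x'‖) ^ (γ : ℝ) / γ) := by ring
      _ ≤ A * C * c₃ * (7 * D / γ) := mul_le_mul_of_nonneg_left this (by positivity)
  have bP' : ‖∫ y, P y‖ ≤ B * C * c₃ * (D / (1 - γ)) := by
    refine bP.trans (mul_le_mul_of_nonneg_left ?_ (by positivity))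
    rw [mul_div_assoc']
    exact div_le_div_of_nonneg_right p2 h1γ.le
  -- assembly
  have key : czDiff K f x - czDiff K f x' =
      ((∫ y, θd y • Gx y) - ∫ y, θd y • Gx' y) + ((∫ y, P y) + ∫ y, Q y) := by
    rw [e1, e2, ← e3]
    abel
  rw [key]
  calc ‖((∫ y, θd y • Gx y) - ∫ y, θd y • Gx' y) + ((∫ y, P y) + ∫ y, Q y)‖
      ≤ (‖∫ y, θd y • Gx y‖ + ‖∫ y, θd y • Gx' y‖) + (‖∫ y, P y‖ + ‖∫ y, Q y‖) :=
        (norm_add_le _ _).trans (add_le_add (norm_sub_le _ _) (norm_add_le _ _))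
    _ ≤ A * C * c₃ * (7 * D / γ) + (B * C * c₃ * (D / (1 - γ)) + A₀ * C * D) :=
        add_le_add bN (add_le_add bP' bQ)
    _ = C * (7 * A * c₃ / γ + B * c₃ / (1 - γ) + A₀) * D := by ring

/-- **`HolderWith` form of the estimate**: the singular integral on differences of a `γ`-Hölder
function is `γ`-Hölder, with constant `C (7A·3|B₁|/γ + B·3|B₁|/(1−γ) + A₀)`. [cite: MajdaBertozziCUP2002, §4.1.3 Lemma 4.6 (4.36) (p. 129)] -/
theorem IsHolderCZKernel.holderWith_czDiff (hK : IsHolderCZKernel K ρ A B A₀) (hf : HolderWith C γ f)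
    (hγ : 0 < γ) (hγ1 : γ < 1) :
    HolderWith (C * Real.toNNReal (7 * A * (3 * (volume : Measure ℝ³).real (ball 0 1)) / γ +
        B * (3 * (volume : Measure ℝ³).real (ball 0 1)) / (1 - γ) + A₀)) γ (czDiff K f) := by
  have hγ1' : (γ : ℝ) < 1 := by exact_mod_cast hγ1
  have hγ' : (0 : ℝ) < γ := by exact_mod_cast hγ
  set M : ℝ := 7 * A * (3 * (volume : Measure ℝ³).real (ball 0 1)) / γ +
    B * (3 * (volume : Measure ℝ³).real (ball 0 1)) / (1 - γ) + A₀ with hM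
  have hM0 : 0 ≤ M := by
    have := hK.nonneg_A
    have := hK.nonneg_B
    have := hK.nonneg_A₀
    have := three_mul_volume_real_ball_nonneg
    have : 0 < 1 - (γ : ℝ) := by linarith
    positivity
  refine FunctionSpaces.holderWith_of_dist_le fun x x' => ?_
  rw [dist_eq_norm, dist_eq_norm, NNReal.coe_mul, Real.coe_toNNReal _ hM0]
  exact hK.norm_czDiff_sub_le hf hγ hγ1 x x'

/-- **Membership form**: `czDiff K f` is `γ`-Hölder (`MemHolder`; the sup bound is the separate
`norm_czDiff_le`). [folklore] -/
theorem IsHolderCZKernel.memHolder_czDiff (hK : IsHolderCZKernel K ρ A B A₀) (hf : HolderWith C γ f)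
    (hγ : 0 < γ) (hγ1 : γ < 1) : MemHolder γ (czDiff K f) :=
  ⟨_, hK.holderWith_czDiff hf hγ hγ1⟩

end Holder

end Literature.Analysis.FluidPDE
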